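import Summits.NavierStokesRegularity.FunctionalMining.TopEigProductionSplit
import Summits.NavierStokesRegularity.FunctionalMining.StrainMomentSaturatingLaw
import HarnessLib

/-!
# FunctionalMining — the Euler production of the `λ₁` moment is dominated by the strain-moment
# production chain (static bounds on `T³`, real `q > 2`)

Search for candidate a priori estimates; no regularity claim. Cell `pub-nsfunc`, prove seat
(gen 24). The dangerous term of the `λ₁` rows isolated in `TopEigProductionSplit`,
`𝒩₊ = ∫ q λ₁^{q−1} μ(S; −Π(p) − N(u))` (transport-free, selection-free), is bounded by the SAME
static chain that closes the strain-moment law `T_LD` for `Z_q = ∫|S|^q` (`StrainMomentProduction`,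
`StrainMomentSaturatingLaw`): pointwise `0 ≤ λ₁ ≤ |S|` and `|μ(S; M)| ≤ ‖M‖`, so
`q λ₁^{q−1} μ(S; −Π − N) ≤ q |S|^{q−1} (∑ᵢⱼ|∂ᵢ∂ⱼp| + ∑ₖ‖∂ₖu‖²)`, and then Hölder, strain
Calderón–Zygmund at `2q`, the top node `∫|S|^{3q} ≤ C_T I³` and interpolation give

* `TopEig.integral_norm_rpow_mul_gradSq_le` — `∫ |S|^{q−1} ∑ₖ‖∂ₖv‖² ≤ √2 K^{1/q} (C_T I³)^{a/3} M^{1−a}`;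
* `TopEig.integral_norm_rpow_mul_hessAbs_le` — along an unforced classical solution,
  `∫ |S|^{q−1} ∑ᵢⱼ|∂ᵢ∂ⱼp| ≤ √2 (9^q C_P K)^{1/q} (C_T I³)^{a/3} M^{1−a}`;
* **`TopEig.eulerProduction_le_chain`** — along an unforced classical solution on `T³`, `q > 2`:
  `∫ q λ₁^{q−1} μ(S; −Π(p) − N(u)) ≤ q (C_N + C_Q) I^a M^{1−a}`,

with `I = ∫|S|^{q−2}|∇S|²` the strain-moment dissipation, `M = (∫|S|²)(∫|S|^q)^{1+1/(2q−3)}`,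
`a = (3q−3)/(5q−6)`, `C_N = √2 K^{1/q} C_T^{a/3}`, `C_Q = √2 (9^q C_P K)^{1/q} C_T^{a/3}` — EXACTLY the
quantities of the proof of `StrainMoment.strainMoment_saturatingLaw`. Used by
`TopEigStrainMixLawHolds` (K1-Q6 (a): the mixtures `Φ_q + ε Z_q` obey `T_LD` for every `ε > 0`).
Constants existential (Sobolev top node, strain and pressure-Hessian Calderón–Zygmund).
[ours; adapted from `StrainMomentProduction` (same chain, cruder integrand)]
-/

noncomputable section

open MeasureTheory Set Filter Topology Finset

namespace Summit.NavierStokesRegularity.FunctionalMining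

open Literature.Analysis.FunctionSpaces Literature.Analysis.FluidPDE

namespace TopEig

open StrainL4 StrainMoment VorticityL4 StrainTensor Torus

/-! ## 1. The two integrals `∫|S|^{q−1} g` and `∫|S|^{q−1} h` through the strain-moment chain -/

/-- **`∫ |S|^{q−1} ∑ₖ‖∂ₖv‖² ≤ √2 K^{1/q} (C_T I³)^{a/3} M^{1−a}`** for smooth divergence-free `v` on
`T³`, real `q > 2` (Hölder, strain Calderón–Zygmund at `2q`, top node, interpolation — the chain of
`StrainMoment.nonlinear_production_rpow_le`, applied to the cruder integrand). [ours] -/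
theorem integral_norm_rpow_mul_gradSq_le {CT K q : ℝ} (hK0 : 0 ≤ K) (hq : 2 < q)
    (hCT : ∀ w : UnitAddTorus (Fin 3) → EuclideanSpace ℝ (Fin 3), IsSmooth w →
      ∫ x, ‖strainFlat w x‖ ^ (3 * q) ≤
        CT * (∫ x, ‖strainFlat w x‖ ^ (q - 2) * ∑ k, ∑ i, ∑ j,
          ((partialDeriv k (partialDeriv j w) x i +
            partialDeriv k (partialDeriv i w) x j) / 2) ^ 2) ^ 3)
    (hK : ∀ w : UnitAddTorus (Fin 3) → EuclideanSpace ℝ (Fin 3), IsSmooth w → IsDivFree w →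
      ∫ x, (∑ k, ‖partialDeriv k w x‖ ^ 2) ^ q ≤ K * ∫ x, ‖strainFlat w x‖ ^ (2 * q))
    {v : UnitAddTorus (Fin 3) → EuclideanSpace ℝ (Fin 3)} (hv : IsSmooth v) (hdiv : IsDivFree v) :
    ∫ x, ‖strainFlat v x‖ ^ (q - 1) * ∑ k, ‖partialDeriv k v x‖ ^ 2 ≤
      Real.sqrt 2 * K ^ (1 / q) *
        (CT * (∫ x, ‖strainFlat v x‖ ^ (q - 2) * ∑ k, ∑ i, ∑ j,
          ((partialDeriv k (partialDeriv j v) x i +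
            partialDeriv k (partialDeriv i v) x j) / 2) ^ 2) ^ 3) ^
          ((3 * q - 3) / (5 * q - 6) / 3) *
        ((∫ x, ‖strainFlat v x‖ ^ (2 : ℝ)) *
          (∫ x, ‖strainFlat v x‖ ^ q) ^ (1 + (2 * q - 3)⁻¹)) ^ (1 - (3 * q - 3) / (5 * q - 6)) := by
  -- adapted from StrainMomentProduction.nonlinear_production_rpow_le
  have hφc : Continuous (strainFlat v) := continuous_strainFlat hv
  have hgc := VorticityL4.continuous_gradSq hv
  have hg0 : ∀ x, 0 ≤ ∑ k, ‖partialDeriv k v x‖ ^ 2 := fun x =>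
    Finset.sum_nonneg fun k _ => sq_nonneg _
  obtain ⟨F, hF⟩ : ∃ F : ℝ, F = ∫ x, ‖strainFlat v x‖ ^ q := ⟨_, rfl⟩
  obtain ⟨G, hG⟩ : ∃ G : ℝ, G = ∫ x, (∑ k, ‖partialDeriv k v x‖ ^ 2) ^ q := ⟨_, rfl⟩
  obtain ⟨A₂, hA₂⟩ : ∃ A : ℝ, A = ∫ x, ‖strainFlat v x‖ ^ (2 * q) := ⟨_, rfl⟩
  obtain ⟨A, hA⟩ : ∃ A : ℝ, A = ∫ x, ‖strainFlat v x‖ ^ (3 * q) := ⟨_, rfl⟩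
  obtain ⟨Z, hZ⟩ : ∃ Z : ℝ, Z = ∫ x, ‖strainFlat v x‖ ^ (2 : ℝ) := ⟨_, rfl⟩
  obtain ⟨I, hI⟩ : ∃ I : ℝ, I = ∫ x, ‖strainFlat v x‖ ^ (q - 2) * ∑ k, ∑ i, ∑ j,
      ((partialDeriv k (partialDeriv j v) x i +
        partialDeriv k (partialDeriv i v) x j) / 2) ^ 2 := ⟨_, rfl⟩
  rw [← hF, ← hZ, ← hI]
  have hF0 : 0 ≤ F := by rw [hF]; exact integral_nonneg fun x => Real.rpow_nonneg (norm_nonneg _) _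
  have hG0 : 0 ≤ G := by rw [hG]; exact integral_nonneg fun x => Real.rpow_nonneg (hg0 x) _
  have hA₂0 : 0 ≤ A₂ := by rw [hA₂]; exact integral_nonneg fun x => Real.rpow_nonneg (norm_nonneg _) _
  have hA0 : 0 ≤ A := by rw [hA]; exact integral_nonneg fun x => Real.rpow_nonneg (norm_nonneg _) _
  have hZ0 : 0 ≤ Z := by rw [hZ]; exact integral_nonneg fun x => Real.rpow_nonneg (norm_nonneg _) _
  have h1 : ∫ x, ‖strainFlat v x‖ ^ (q - 1) * ∑ k, ‖partialDeriv k v x‖ ^ 2 ≤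
      Real.sqrt 2 * (F ^ ((q - 1) / q) * G ^ (1 / q)) := by
    have h' := integral_rpow_mul_le_holder hφc.norm hgc (fun x => norm_nonneg _) hg0
      (by linarith : 1 < q)
    rw [← hF, ← hG] at h'
    have hP0 : 0 ≤ F ^ ((q - 1) / q) * G ^ (1 / q) :=
      mul_nonneg (Real.rpow_nonneg hF0 _) (Real.rpow_nonneg hG0 _)
    have h2 : (1 : ℝ) ≤ Real.sqrt 2 := Real.one_le_sqrt.2 (by norm_num)
    calc _ ≤ F ^ ((q - 1) / q) * G ^ (1 / q) := h'
      _ = 1 * (F ^ ((q - 1) / q) * G ^ (1 / q)) := (one_mul _).symm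
      _ ≤ Real.sqrt 2 * (F ^ ((q - 1) / q) * G ^ (1 / q)) := mul_le_mul_of_nonneg_right h2 hP0
  have h2 : G ≤ K * A₂ := by rw [hG, hA₂]; exact hK v hv hdiv
  have h3 : A₂ ^ 2 ≤ F * A := by rw [hA₂, hF, hA]; exact moment_two_q_sq_le hφc (by linarith)
  have h4 : A ≤ CT * I ^ 3 := by rw [hA, hI]; exact hCT v hv
  have h5 : F ≤ Z ^ (2 * q / (3 * q - 2)) * A ^ (1 - 2 * q / (3 * q - 2)) := by
    rw [hF, hZ, hA]; exact moment_q_le_interp hφc hq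
  exact VorticityMoment.production_rpow_bookkeeping hq hF0 hG0 hA₂0 hA0 hZ0 hK0 h1 h2 h3 h4 h5

/-- **`∫ |S|^{q−1} ∑ᵢⱼ|∂ᵢ∂ⱼp| ≤ √2 (9^q C_P K)^{1/q} (C_T I³)^{a/3} M^{1−a}`** along an unforced
classical solution on `T³` (real `q > 2`; `C_P` a pressure-Hessian Calderón–Zygmund constant at `q`
along the solution) — the chain of `StrainMoment.pressure_production_rpow_le`. [ours] -/
theorem integral_norm_rpow_mul_hessAbs_le {CT K CP q : ℝ} (hK0 : 0 ≤ K) (hCP0 : 0 ≤ CP) (hq : 2 < q)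
    (hCT : ∀ w : UnitAddTorus (Fin 3) → EuclideanSpace ℝ (Fin 3), IsSmooth w →
      ∫ x, ‖strainFlat w x‖ ^ (3 * q) ≤
        CT * (∫ x, ‖strainFlat w x‖ ^ (q - 2) * ∑ k, ∑ i, ∑ j,
          ((partialDeriv k (partialDeriv j w) x i +
            partialDeriv k (partialDeriv i w) x j) / 2) ^ 2) ^ 3)
    (hK : ∀ w : UnitAddTorus (Fin 3) → EuclideanSpace ℝ (Fin 3), IsSmooth w → IsDivFree w →
      ∫ x, (∑ k, ‖partialDeriv k w x‖ ^ 2) ^ q ≤ K * ∫ x, ‖strainFlat w x‖ ^ (2 * q))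
    {a b ν : ℝ}
    {u : ℝ → UnitAddTorus (Fin 3) → EuclideanSpace ℝ (Fin 3)} {p : ℝ → UnitAddTorus (Fin 3) → ℝ}
    (hsol : IsClassicalNSSolutionOn (Icc a b) ν 0 u p)
    (hCP : ∀ t ∈ Icc a b, ∀ i j : Fin 3,
      ∫ x, |partialDeriv i (partialDeriv j (p t)) x| ^ q ≤
        CP * ∫ x, (∑ k, ‖partialDeriv k (u t) x‖ ^ 2) ^ q)
    {t : ℝ} (ht : t ∈ Icc a b) :
    ∫ x, ‖strainFlat (u t) x‖ ^ (q - 1) * ∑ i, ∑ j, |partialDeriv i (partialDeriv j (p t)) x| ≤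
      Real.sqrt 2 * ((9 : ℝ) ^ q * CP * K) ^ (1 / q) *
        (CT * (∫ x, ‖strainFlat (u t) x‖ ^ (q - 2) * ∑ k, ∑ i, ∑ j,
          ((partialDeriv k (partialDeriv j (u t)) x i +
            partialDeriv k (partialDeriv i (u t)) x j) / 2) ^ 2) ^ 3) ^
          ((3 * q - 3) / (5 * q - 6) / 3) *
        ((∫ x, ‖strainFlat (u t) x‖ ^ (2 : ℝ)) *
          (∫ x, ‖strainFlat (u t) x‖ ^ q) ^ (1 + (2 * q - 3)⁻¹)) ^
          (1 - (3 * q - 3) / (5 * q - 6)) := by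
  -- adapted from StrainMomentProduction.pressure_production_rpow_le
  have hv : IsSmooth (u t) := hsol.smooth_velocity.isSmooth_slice ht
  have hdiv : IsDivFree (u t) := hsol.divFree t ht
  have hpt : IsSmooth (p t) := hsol.smooth_pressure.isSmooth_slice ht
  have hφc : Continuous (strainFlat (u t)) := continuous_strainFlat hv
  have hhc := continuous_hessAbs hpt
  have hh0 : ∀ x, 0 ≤ ∑ i, ∑ j, |partialDeriv i (partialDeriv j (p t)) x| := fun x =>
    Finset.sum_nonneg fun i _ => Finset.sum_nonneg fun j _ => abs_nonneg _
  have hg0 : ∀ x, 0 ≤ ∑ k, ‖partialDeriv k (u t) x‖ ^ 2 := fun x =>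
    Finset.sum_nonneg fun k _ => sq_nonneg _
  have hq1 : (1 : ℝ) ≤ q := by linarith
  obtain ⟨F, hF⟩ : ∃ F : ℝ, F = ∫ x, ‖strainFlat (u t) x‖ ^ q := ⟨_, rfl⟩
  obtain ⟨Hq, hHq⟩ : ∃ H : ℝ, H = ∫ x, (∑ i, ∑ j, |partialDeriv i (partialDeriv j (p t)) x|) ^ q :=
    ⟨_, rfl⟩
  obtain ⟨G, hG⟩ : ∃ G : ℝ, G = ∫ x, (∑ k, ‖partialDeriv k (u t) x‖ ^ 2) ^ q := ⟨_, rfl⟩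
  obtain ⟨A₂, hA₂⟩ : ∃ A : ℝ, A = ∫ x, ‖strainFlat (u t) x‖ ^ (2 * q) := ⟨_, rfl⟩
  obtain ⟨A, hA⟩ : ∃ A : ℝ, A = ∫ x, ‖strainFlat (u t) x‖ ^ (3 * q) := ⟨_, rfl⟩
  obtain ⟨Z, hZ⟩ : ∃ Z : ℝ, Z = ∫ x, ‖strainFlat (u t) x‖ ^ (2 : ℝ) := ⟨_, rfl⟩
  obtain ⟨I, hI⟩ : ∃ I : ℝ, I = ∫ x, ‖strainFlat (u t) x‖ ^ (q - 2) * ∑ k, ∑ i, ∑ j,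
      ((partialDeriv k (partialDeriv j (u t)) x i +
        partialDeriv k (partialDeriv i (u t)) x j) / 2) ^ 2 := ⟨_, rfl⟩
  rw [← hF, ← hZ, ← hI]
  have hF0 : 0 ≤ F := by rw [hF]; exact integral_nonneg fun x => Real.rpow_nonneg (norm_nonneg _) _
  have hHq0 : 0 ≤ Hq := by rw [hHq]; exact integral_nonneg fun x => Real.rpow_nonneg (hh0 x) _
  have hG0 : 0 ≤ G := by rw [hG]; exact integral_nonneg fun x => Real.rpow_nonneg (hg0 x) _
  have hA₂0 : 0 ≤ A₂ := by rw [hA₂]; exact integral_nonneg fun x => Real.rpow_nonneg (norm_nonneg _) _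
  have hA0 : 0 ≤ A := by rw [hA]; exact integral_nonneg fun x => Real.rpow_nonneg (norm_nonneg _) _
  have hZ0 : 0 ≤ Z := by rw [hZ]; exact integral_nonneg fun x => Real.rpow_nonneg (norm_nonneg _) _
  have h1 : ∫ x, ‖strainFlat (u t) x‖ ^ (q - 1) * ∑ i, ∑ j, |partialDeriv i (partialDeriv j (p t)) x| ≤
      Real.sqrt 2 * (F ^ ((q - 1) / q) * Hq ^ (1 / q)) := by
    have h' := integral_rpow_mul_le_holder hφc.norm hhc (fun x => norm_nonneg _) hh0
      (by linarith : 1 < q)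
    rw [← hF, ← hHq] at h'
    have hP0 : 0 ≤ F ^ ((q - 1) / q) * Hq ^ (1 / q) :=
      mul_nonneg (Real.rpow_nonneg hF0 _) (Real.rpow_nonneg hHq0 _)
    have h2 : (1 : ℝ) ≤ Real.sqrt 2 := Real.one_le_sqrt.2 (by norm_num)
    calc _ ≤ F ^ ((q - 1) / q) * Hq ^ (1 / q) := h'
      _ = 1 * (F ^ ((q - 1) / q) * Hq ^ (1 / q)) := (one_mul _).symm
      _ ≤ Real.sqrt 2 * (F ^ ((q - 1) / q) * Hq ^ (1 / q)) := mul_le_mul_of_nonneg_right h2 hP0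
  have h2 : Hq ≤ (9 : ℝ) ^ q * CP * K * A₂ := by
    have hH := integral_sum_abs_rpow_le (d := Fin 3)
      (H := fun i j x => partialDeriv i (partialDeriv j (p t)) x)
      (fun i j => ((hpt.partialDeriv j).partialDeriv i).continuous) hq1
    simp only [Fintype.card_fin, Nat.cast_ofNat] at hH
    have hsum : ∑ i : Fin 3, ∑ j : Fin 3, ∫ x, |partialDeriv i (partialDeriv j (p t)) x| ^ q ≤
        ∑ i : Fin 3, ∑ j : Fin 3, CP * G := by
      refine Finset.sum_le_sum fun i _ => Finset.sum_le_sum fun j _ => ?_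
      rw [hG]; exact hCP t ht i j
    have hsum' : ∑ i : Fin 3, ∑ j : Fin 3, CP * G = 9 * (CP * G) := by
      simp only [Finset.sum_const, Finset.card_univ, Fintype.card_fin]
      ring
    have hGle : G ≤ K * A₂ := by rw [hG, hA₂]; exact hK (u t) hv hdiv
    have h9 : ((3 : ℝ) ^ 2) ^ (q - 1) * 9 = (9 : ℝ) ^ q := by
      rw [show (3 : ℝ) ^ 2 = 9 by norm_num, Real.rpow_sub (by norm_num : (0 : ℝ) < 9),
        Real.rpow_one]
      field_simp
    have h9q : 0 ≤ ((3 : ℝ) ^ 2) ^ (q - 1) := Real.rpow_nonneg (by norm_num) _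
    calc Hq ≤ ((3 : ℝ) ^ 2) ^ (q - 1) *
          ∑ i : Fin 3, ∑ j : Fin 3, ∫ x, |partialDeriv i (partialDeriv j (p t)) x| ^ q := by
          rw [hHq]; exact hH
      _ ≤ ((3 : ℝ) ^ 2) ^ (q - 1) * (9 * (CP * G)) := by
          rw [← hsum']; exact mul_le_mul_of_nonneg_left hsum h9q
      _ ≤ ((3 : ℝ) ^ 2) ^ (q - 1) * (9 * (CP * (K * A₂))) := by gcongr
      _ = (((3 : ℝ) ^ 2) ^ (q - 1) * 9) * CP * K * A₂ := by ring
      _ = (9 : ℝ) ^ q * CP * K * A₂ := by rw [h9]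
  have h3 : A₂ ^ 2 ≤ F * A := by rw [hA₂, hF, hA]; exact moment_two_q_sq_le hφc (by linarith)
  have h4 : A ≤ CT * I ^ 3 := by rw [hA, hI]; exact hCT (u t) hv
  have h5 : F ≤ Z ^ (2 * q / (3 * q - 2)) * A ^ (1 - 2 * q / (3 * q - 2)) := by
    rw [hF, hZ, hA]; exact moment_q_le_interp hφc hq
  have h9K : 0 ≤ (9 : ℝ) ^ q * CP * K := by positivity
  exact VorticityMoment.production_rpow_bookkeeping hq hF0 hHq0 hA₂0 hA0 hZ0 h9K h1 h2 h3 h4 h5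

/-! ## 2. The Euler production of `Φ_q` against these integrals -/

/-- **Pointwise**: `q λ₁^{q−1} μ(S; −Π(P) − N(w)) ≤ q |S|^{q−1} (∑ᵢⱼ|∂ᵢ∂ⱼP| + ∑ₖ‖∂ₖw‖²)` for smooth
divergence-free `w` (`0 ≤ λ₁ ≤ |S|`, `|μ(S; M)| ≤ ‖M‖`, `‖Π‖ ≤ ∑|∂ᵢ∂ⱼP|`, `‖N‖ ≤ ∑‖∂ₖw‖²`; `q ≥ 1`).
[ours] -/
theorem topEigDensity_hessian_le {d : Type*} [Fintype d] [DecidableEq d] [Nonempty d] {q : ℝ}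
    (hq : 1 ≤ q) {w : UnitAddTorus d → EuclideanSpace ℝ d} (hw : IsSmooth w) (hdw : IsDivFree w)
    (P : UnitAddTorus d → ℝ) (x : UnitAddTorus d) :
    q * torusStrainTopEig w x ^ (q - 1) * dirTopEig (strainFlat w x) (-pressVec P x - nonlinVec w x) ≤
      q * (‖strainFlat w x‖ ^ (q - 1) * (∑ i, ∑ j, |partialDeriv i (partialDeriv j P) x| +
        ∑ k, ‖partialDeriv k w x‖ ^ 2)) := by
  have hl0 : 0 ≤ torusStrainTopEig w x := by
    rw [← lam_strainFlat]; exact lam_strainFlat_nonneg hw hdw x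
  have hlS : torusStrainTopEig w x ≤ ‖strainFlat w x‖ := by
    rw [← lam_strainFlat]; exact lam_le_norm _
  have hW : 0 ≤ torusStrainTopEig w x ^ (q - 1) := Real.rpow_nonneg hl0 _
  have hWS : torusStrainTopEig w x ^ (q - 1) ≤ ‖strainFlat w x‖ ^ (q - 1) :=
    Real.rpow_le_rpow hl0 hlS (by linarith)
  have hμ : dirTopEig (strainFlat w x) (-pressVec P x - nonlinVec w x) ≤
      ∑ i, ∑ j, |partialDeriv i (partialDeriv j P) x| + ∑ k, ‖partialDeriv k w x‖ ^ 2 := by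
    refine (dirTopEig_le_norm _ _).trans ?_
    calc ‖-pressVec P x - nonlinVec w x‖ ≤ ‖-pressVec P x‖ + ‖nonlinVec w x‖ := norm_sub_le _ _
      _ = ‖pressVec P x‖ + ‖nonlinVec w x‖ := by rw [norm_neg]
      _ ≤ _ := add_le_add (norm_pressVec_le P x) (norm_nonlinVec_le w x)
  have hB0 : 0 ≤ ∑ i, ∑ j, |partialDeriv i (partialDeriv j P) x| + ∑ k, ‖partialDeriv k w x‖ ^ 2 :=
    add_nonneg (Finset.sum_nonneg fun i _ => Finset.sum_nonneg fun j _ => abs_nonneg _)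
      (Finset.sum_nonneg fun k _ => sq_nonneg _)
  rw [mul_assoc]
  refine mul_le_mul_of_nonneg_left ?_ (by linarith)
  calc torusStrainTopEig w x ^ (q - 1) * dirTopEig (strainFlat w x) (-pressVec P x - nonlinVec w x)
      ≤ torusStrainTopEig w x ^ (q - 1) *
        (∑ i, ∑ j, |partialDeriv i (partialDeriv j P) x| + ∑ k, ‖partialDeriv k w x‖ ^ 2) :=
        mul_le_mul_of_nonneg_left hμ hW
    _ ≤ ‖strainFlat w x‖ ^ (q - 1) *
        (∑ i, ∑ j, |partialDeriv i (partialDeriv j P) x| + ∑ k, ‖partialDeriv k w x‖ ^ 2) :=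
        mul_le_mul_of_nonneg_right hWS hB0

/-- **The Euler production of `Φ_q` is dominated by the strain-moment chain.** Along an unforced
classical solution on `T³`, real `q > 2`, at every time `t` of the window:
`∫ q λ₁^{q−1} μ(S; −Π(p) − N(u)) ≤ q (C_N + C_Q) I^a M^{1−a}` with the constants and quantities of
`StrainMoment.strainMoment_saturatingLaw` (`C_N = √2 K^{1/q} C_T^{a/3}`,
`C_Q = √2 (9^q C_P K)^{1/q} C_T^{a/3}`, `I` the strain-moment dissipation, `M = Z · Z_q^{1+1/(2q−3)}`).
Search for candidate a priori estimates; no regularity claim. [ours] -/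
theorem eulerProduction_le_chain {CT K CP q : ℝ} (hK0 : 0 ≤ K) (hCP0 : 0 ≤ CP) (hCT0 : 0 ≤ CT)
    (hq : 2 < q)
    (hCT : ∀ w : UnitAddTorus (Fin 3) → EuclideanSpace ℝ (Fin 3), IsSmooth w →
      ∫ x, ‖strainFlat w x‖ ^ (3 * q) ≤
        CT * (∫ x, ‖strainFlat w x‖ ^ (q - 2) * ∑ k, ∑ i, ∑ j,
          ((partialDeriv k (partialDeriv j w) x i +
            partialDeriv k (partialDeriv i w) x j) / 2) ^ 2) ^ 3)
    (hK : ∀ w : UnitAddTorus (Fin 3) → EuclideanSpace ℝ (Fin 3), IsSmooth w → IsDivFree w →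
      ∫ x, (∑ k, ‖partialDeriv k w x‖ ^ 2) ^ q ≤ K * ∫ x, ‖strainFlat w x‖ ^ (2 * q))
    {a b ν : ℝ}
    {u : ℝ → UnitAddTorus (Fin 3) → EuclideanSpace ℝ (Fin 3)} {p : ℝ → UnitAddTorus (Fin 3) → ℝ}
    (hsol : IsClassicalNSSolutionOn (Icc a b) ν 0 u p)
    (hCP : ∀ t ∈ Icc a b, ∀ i j : Fin 3,
      ∫ x, |partialDeriv i (partialDeriv j (p t)) x| ^ q ≤
        CP * ∫ x, (∑ k, ‖partialDeriv k (u t) x‖ ^ 2) ^ q)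
    {t : ℝ} (ht : t ∈ Icc a b) :
    ∫ x, q * torusStrainTopEig (u t) x ^ (q - 1) *
        dirTopEig (strainFlat (u t) x) (-pressVec (p t) x - nonlinVec (u t) x) ≤
      q * ((Real.sqrt 2 * K ^ (1 / q) * CT ^ ((3 * q - 3) / (5 * q - 6) / 3) +
          Real.sqrt 2 * ((9 : ℝ) ^ q * CP * K) ^ (1 / q) * CT ^ ((3 * q - 3) / (5 * q - 6) / 3)) *
        (∫ x, ‖strainFlat (u t) x‖ ^ (q - 2) * ∑ k, ∑ i, ∑ j,
          ((partialDeriv k (partialDeriv j (u t)) x i +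
            partialDeriv k (partialDeriv i (u t)) x j) / 2) ^ 2) ^ ((3 * q - 3) / (5 * q - 6)) *
        ((∫ x, ‖strainFlat (u t) x‖ ^ (2 : ℝ)) *
          (∫ x, ‖strainFlat (u t) x‖ ^ q) ^ (1 + (2 * q - 3)⁻¹)) ^ (1 - (3 * q - 3) / (5 * q - 6))) := by
  have hv : IsSmooth (u t) := hsol.smooth_velocity.isSmooth_slice ht
  have hdiv : IsDivFree (u t) := hsol.divFree t ht
  have hpt : IsSmooth (p t) := hsol.smooth_pressure.isSmooth_slice ht
  have hq1 : (1 : ℝ) ≤ q := by linarith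
  have hφc : Continuous (strainFlat (u t)) := continuous_strainFlat hv
  have hhc := continuous_hessAbs hpt
  have hgc := VorticityL4.continuous_gradSq hv
  -- the integrals
  obtain ⟨I, hI⟩ : ∃ I : ℝ, I = ∫ x, ‖strainFlat (u t) x‖ ^ (q - 2) * ∑ k, ∑ i, ∑ j,
      ((partialDeriv k (partialDeriv j (u t)) x i +
        partialDeriv k (partialDeriv i (u t)) x j) / 2) ^ 2 := ⟨_, rfl⟩
  obtain ⟨M, hM⟩ : ∃ M : ℝ, M = (∫ x, ‖strainFlat (u t) x‖ ^ (2 : ℝ)) *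
      (∫ x, ‖strainFlat (u t) x‖ ^ q) ^ (1 + (2 * q - 3)⁻¹) := ⟨_, rfl⟩
  obtain ⟨e, he⟩ : ∃ e : ℝ, e = (3 * q - 3) / (5 * q - 6) := ⟨_, rfl⟩
  have hI0 : 0 ≤ I := by
    rw [hI]; exact integral_nonneg fun x => mul_nonneg (Real.rpow_nonneg (norm_nonneg _) _)
      (Finset.sum_nonneg fun k _ => Finset.sum_nonneg fun i _ =>
        Finset.sum_nonneg fun j _ => sq_nonneg _)
  have hsplit : (CT * I ^ 3) ^ (e / 3) = CT ^ (e / 3) * I ^ e := by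
    rw [Real.mul_rpow hCT0 (pow_nonneg hI0 3), ← Real.rpow_natCast I 3, ← Real.rpow_mul hI0]
    congr 2
    push_cast
    ring
  -- the two chain bounds
  have hN := integral_norm_rpow_mul_gradSq_le hK0 hq hCT hK hv hdiv
  have hP := integral_norm_rpow_mul_hessAbs_le hK0 hCP0 hq hCT hK hsol hCP ht
  rw [← hI, ← hM, ← he, hsplit] at hN hP
  rw [← hI, ← hM, ← he]
  -- the pointwise bound, integrated
  have hint_L : Integrable (fun x => q * torusStrainTopEig (u t) x ^ (q - 1) *
      dirTopEig (strainFlat (u t) x) (-pressVec (p t) x - nonlinVec (u t) x)) volume :=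
    integrable_topEigDensity hq1 hv hdiv
      ((isSmooth_pressVec hpt).continuous.neg.sub (isSmooth_nonlinVec hv).continuous)
  have hRc : Continuous fun x => q * (‖strainFlat (u t) x‖ ^ (q - 1) *
      (∑ i, ∑ j, |partialDeriv i (partialDeriv j (p t)) x| + ∑ k, ‖partialDeriv k (u t) x‖ ^ 2)) :=
    continuous_const.mul ((VelocityMoment.continuous_norm_rpow' hφc (by linarith)).mul (hhc.add hgc))
  have hle : ∫ x, q * torusStrainTopEig (u t) x ^ (q - 1) *
      dirTopEig (strainFlat (u t) x) (-pressVec (p t) x - nonlinVec (u t) x) ≤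
      ∫ x, q * (‖strainFlat (u t) x‖ ^ (q - 1) *
        (∑ i, ∑ j, |partialDeriv i (partialDeriv j (p t)) x| + ∑ k, ‖partialDeriv k (u t) x‖ ^ 2)) :=
    integral_mono hint_L hRc.integrable_unitAddTorus fun x => topEigDensity_hessian_le hq1 hv hdiv (p t) x
  have hsum : ∫ x, q * (‖strainFlat (u t) x‖ ^ (q - 1) *
      (∑ i, ∑ j, |partialDeriv i (partialDeriv j (p t)) x| + ∑ k, ‖partialDeriv k (u t) x‖ ^ 2)) =
      q * ((∫ x, ‖strainFlat (u t) x‖ ^ (q - 1) * ∑ i, ∑ j, |partialDeriv i (partialDeriv j (p t)) x|) +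
        ∫ x, ‖strainFlat (u t) x‖ ^ (q - 1) * ∑ k, ‖partialDeriv k (u t) x‖ ^ 2) := by
    have hφr : Continuous fun x => ‖strainFlat (u t) x‖ ^ (q - 1) :=
      VelocityMoment.continuous_norm_rpow' hφc (by linarith)
    have hi1 : Integrable (fun x => ‖strainFlat (u t) x‖ ^ (q - 1) *
        ∑ i, ∑ j, |partialDeriv i (partialDeriv j (p t)) x|) volume :=
      (hφr.mul hhc).integrable_unitAddTorus
    have hi2 : Integrable (fun x => ‖strainFlat (u t) x‖ ^ (q - 1) *
        ∑ k, ‖partialDeriv k (u t) x‖ ^ 2) volume := (hφr.mul hgc).integrable_unitAddTorus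
    rw [integral_const_mul, ← integral_add hi1 hi2]
    congr 1
    refine integral_congr_ae (ae_of_all _ fun x => ?_)
    ring
  rw [hsum] at hle
  have hq0 : 0 ≤ q := by linarith
  calc _ ≤ q * ((∫ x, ‖strainFlat (u t) x‖ ^ (q - 1) * ∑ i, ∑ j, |partialDeriv i (partialDeriv j (p t)) x|) +
        ∫ x, ‖strainFlat (u t) x‖ ^ (q - 1) * ∑ k, ‖partialDeriv k (u t) x‖ ^ 2) := hle
    _ ≤ q * (Real.sqrt 2 * ((9 : ℝ) ^ q * CP * K) ^ (1 / q) * (CT ^ (e / 3) * I ^ e) * M ^ (1 - e) +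
        Real.sqrt 2 * K ^ (1 / q) * (CT ^ (e / 3) * I ^ e) * M ^ (1 - e)) :=
        mul_le_mul_of_nonneg_left (add_le_add hP hN) hq0
    _ = _ := by ring

end TopEig

end Summit.NavierStokesRegularity.FunctionalMining

end
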